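import Literature.Computability.AlgebraicComplexity.StrongUSP
import Mathlib.Data.Nat.Bitwise
import Mathlib.Algebra.BigOperators.Intervals
import Mathlib.Data.Fintype.Sigma
import Mathlib.Logic.Equiv.Fintype
import Mathlib.Analysis.SpecialFunctions.Pow.Real
import HarnessLib

/-!
# The CKSU strong USP of size `2^(k-1) (2^k + 1)` and width `3k` (Cohn–Kleinberg–Szegedy–Umans 2005, Prop. 3.8 / 18) and the Cohn–Umans triangle

Topic `Literature/Computability/AlgebraicComplexity` (group-theoretic matrix multiplication), companion of
`StrongUSP.lean` / `StrongUSPFamilies.lean`.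

* **Cohn–Umans 2003, Theorem 6 (arXiv numbering; §3 "The pseudo-exponent", the triangle construction)** — the
  combinatorial core AS PRINTED: with `Δₙ = {(a,b,c) ∈ ℤ³ : a+b+c = n−1, a,b,c ≥ 0}` and `Hᵢ ≤ Sym(Δₙ)` the
  subgroup fixing the `i`-th coordinate, "if `h₁h₂h₃ = 1` with `hᵢ ∈ Hᵢ`, then `h₁ = h₂ = h₃ = 1`" — proved as
  printed, by induction along the lexicographic order of the triples (`TriPt.triangle_tpp`).
* **Cohn–Kleinberg–Szegedy–Umans 2005, Proposition 18 (arXiv numbering; = Prop. 3.8)** AS PRINTED: "For each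
  `k ≥ 1`, there exists a strong USP of size `2^{k−1}(2^k+1)` and width `3k`." with the printed construction:
  rows indexed by `Δₙ`, `n = 2^k`; "Among the first `k` coordinates, only `1` and `2` will occur, among the second
  `k` only `2` and `3`, and among the third `k` only `1` and `3`"; the row of `(a,b,c)` carries "the `a`-th
  pattern in the first `k` coordinates, the `b`-th in the second `k`, and the `c`-th in the third" (patterns =
  binary expansions; `cksuTriangleRow`).  The printed proof goes through Lemma 17 (USP ⇔ TPP for `H₁,H₂,H₃`);
  here the same argument is run directly on the strong-USP definition: if no column witnesses "exactly two",
  then (block 1) the first coordinates of `π₁u` and `π₂u` have the same bits for every `u` — by the counting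
  step `comp_eq_of_testBit_imp` (bit-filters have equal cardinality under permutations) — i.e.
  `h₁ := π₁π₂⁻¹ ∈ H₁`; likewise `h₂ := π₂π₃⁻¹ ∈ H₂` (block 2) and `h₃ := π₃π₁⁻¹ ∈ H₃` (block 3), and
  `h₁h₂h₃ = 1`, so the triangle theorem gives `π₁ = π₂ = π₃` (`cksuTriangle_strong`,
  `isStrongUSP_cksuTriangleUSP`).  "It follows that the strong USP capacity is at least `2^{2/3}` and `ω < 2.48`"
  — the ω-corollary is census-side (`OmegaCensus/`), not in this file.
* Section `Capacity`: the printed consequence "the strong USP capacity is at least `2^{2/3}`" as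
  `exists_isStrongUSP_card_ge_pow` (for every `0 ≤ C < 2^{2/3}` and `K`, a strong USP of width `k ≥ K` with `≥ C^k` rows).

## References
* H. Cohn, C. Umans, *A group-theoretic approach to fast matrix multiplication*, FOCS 2003; arXiv:math/0307321,
  Theorem 6 and its proof (p. 5). [CohnUmans2003]
* H. Cohn, R. Kleinberg, B. Szegedy, C. Umans, *Group-theoretic algorithms for matrix multiplication*, FOCS 2005;
  arXiv:math/0511460, §3, Proposition 18 and its proof (p. 7). [CohnKleinbergSzegedyUmans2005]
-/

namespace Literature.Computability.AlgebraicComplexity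

open Equiv Finset

/-- The discrete triangle `Δₙ = {(a,b,c) ∈ ℕ³ : a + b + c = n − 1}`, coded by the pair `(a,b)` with `a + b < n`
(`c = n − 1 − a − b`). [cite: CohnUmans2003, Theorem 6 (triangle construction)] -/
abbrev TriPt (n : ℕ) : Type := {p : Fin n × Fin n // (p.1 : ℕ) + p.2 < n}

namespace TriPt

variable {n : ℕ}

/-- First coordinate `a`. [cite: CohnUmans2003, Theorem 6] -/
def a (x : TriPt n) : ℕ := x.1.1
/-- Second coordinate `b`. [cite: CohnUmans2003, Theorem 6] -/
def b (x : TriPt n) : ℕ := x.1.2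
/-- Third coordinate `c = n − 1 − a − b`. [cite: CohnUmans2003, Theorem 6] -/
def c (x : TriPt n) : ℕ := n - 1 - (x.a + x.b)

/-- `a + b < n`. [folklore] -/
private theorem ab_lt (x : TriPt n) : x.a + x.b < n := x.2

/-- `b < n`. [folklore] -/
private theorem b_lt (x : TriPt n) : x.b < n := x.1.2.isLt

/-- A point is determined by `(a, b)`. [folklore] -/
private theorem ext' {x y : TriPt n} (ha : x.a = y.a) (hb : x.b = y.b) : x = y :=
  Subtype.ext (Prod.ext (Fin.ext ha) (Fin.ext hb))

/-- `c` is preserved iff `a + b` is. [folklore] -/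
private theorem c_eq_c_iff (x y : TriPt n) : x.c = y.c ↔ x.a + x.b = y.a + y.b := by
  have hx := x.ab_lt; have hy := y.ab_lt
  unfold c; omega

/-- Lexicographic position of `(a,b,c)` ("`(0,0,n−1)` is the smallest triple and `(n−1,0,0)` is the largest"):
the key `a·n + b`. [cite: CohnUmans2003, Theorem 6, proof] -/
def key (x : TriPt n) : ℕ := x.a * n + x.b

/-- A smaller first coordinate means a lexicographically smaller triple. [folklore] -/
private theorem key_lt_key_of_a_lt {x y : TriPt n} (h : x.a < y.a) : x.key < y.key := by
  unfold key
  have hb := x.b_lt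
  calc x.a * n + x.b < x.a * n + n := by omega
    _ = (x.a + 1) * n := by ring
    _ ≤ y.a * n := Nat.mul_le_mul_right _ h
    _ ≤ y.a * n + y.b := Nat.le_add_right _ _

/-- **Cohn–Umans 2003, Theorem 6 (the triangle TPP), proved as printed.**  If `h₁` fixes the first
coordinate of every point, `h₂` the second, `h₃` the third, and `h₁h₂h₃ = 1`, then `h₁ = h₂ = h₃ = 1`.
Printed proof: induct along the lexicographic order; "`h₃` cannot send `(a,b,c)` to a smaller triple, since
all smaller triples are fixed points, so `h₃` must send it to `(a+i,b−i,c)` with `i ≥ 0`. Then `h₂` sends that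
to `(a+i+j,b−i,c−j)` for some `j`. The only way `h₁` can return to `(a,b,c)` is if `i+j = 0` … However, `h₁`
fixes `(a,b−i,c+i)` for `i > 0` …, so we must have `i = 0`."
[cite: CohnUmans2003, Theorem 6 (p. 5) and its proof] -/
theorem triangle_tpp (h₁ h₂ h₃ : Perm (TriPt n))
    (ha : ∀ x, (h₁ x).a = x.a) (hb : ∀ x, (h₂ x).b = x.b) (hc : ∀ x, (h₃ x).c = x.c)
    (hprod : ∀ x, h₁ (h₂ (h₃ x)) = x) : h₁ = 1 ∧ h₂ = 1 ∧ h₃ = 1 := by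
  have main : ∀ N : ℕ, ∀ x : TriPt n, x.key = N → (h₁ x = x ∧ h₂ x = x ∧ h₃ x = x) := by
    intro N
    induction N using Nat.strong_induction_on with
    | _ N ih =>
      intro x hx
      have fix : ∀ y : TriPt n, y.key < x.key → (h₁ y = y ∧ h₂ y = y ∧ h₃ y = y) :=
        fun y hy => ih y.key (hx ▸ hy) y rfl
      -- (1) `h₃ x` is not lexicographically smaller than `x`
      have h3ge : x.key ≤ (h₃ x).key := by
        by_contra hlt
        push Not at hlt
        have hfx : h₃ (h₃ x) = h₃ x := (fix (h₃ x) hlt).2.2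
        have : h₃ x = x := h₃.injective hfx
        rw [this] at hlt
        exact lt_irrefl _ hlt
      -- (2) hence its first coordinate is `a + i`, `i ≥ 0`, and (as `c` is preserved) its second is `b − i`
      have hsum : (h₃ x).a + (h₃ x).b = x.a + x.b := (c_eq_c_iff _ _).mp (hc x)
      have ha3 : x.a ≤ (h₃ x).a := by
        by_contra hlt
        push Not at hlt
        exact absurd (key_lt_key_of_a_lt hlt) (not_lt.mpr h3ge)
      -- (3) `h₂` keeps the second coordinate; `h₁` keeps the first and returns to `x`
      have hx1 : h₁ (h₂ (h₃ x)) = x := hprod x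
      have ha2 : (h₂ (h₃ x)).a = x.a := by
        have := ha (h₂ (h₃ x)); rw [hx1] at this; exact this.symm
      have hb2 : (h₂ (h₃ x)).b = (h₃ x).b := hb (h₃ x)
      -- (4) if `i > 0` then `h₂h₃x = (a, b−i, c+i)` is smaller than `x`, hence fixed by `h₁` — impossible
      have ha3' : (h₃ x).a = x.a := by
        by_contra hne
        have hgt : x.a < (h₃ x).a := lt_of_le_of_ne ha3 (Ne.symm hne)
        have hk2 : (h₂ (h₃ x)).key < x.key := by
          unfold key; rw [ha2, hb2]; omega
        have hfix : h₁ (h₂ (h₃ x)) = h₂ (h₃ x) := (fix _ hk2).1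
        have hxb : x.b = (h₂ (h₃ x)).b := by rw [← hfix, hx1]
        rw [hb2] at hxb
        omega
      have hb3' : (h₃ x).b = x.b := by omega
      have e3 : h₃ x = x := ext' ha3' hb3'
      have e2 : h₂ x = x := by
        have := ext' (x := h₂ (h₃ x)) (y := x) ha2 (hb2.trans hb3')
        rwa [e3] at this
      refine ⟨?_, e2, e3⟩
      have := hx1
      rwa [e3, e2] at this
  have all : ∀ x : TriPt n, h₁ x = x ∧ h₂ x = x ∧ h₃ x = x := fun x => main x.key x rfl
  refine ⟨?_, ?_, ?_⟩ <;> ext x : 1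
  · exact (all x).1
  · exact (all x).2.1
  · exact (all x).2.2

/-- `Δₙ ≃ Σ_{a < n} Fin (n − a)` (`b` ranges over `n − a` values). [folklore] -/
def equivSigma (n : ℕ) : TriPt n ≃ Σ a : Fin n, Fin (n - a) where
  toFun x := ⟨x.1.1, ⟨x.1.2, by have := x.2; have := x.1.1.isLt; omega⟩⟩
  invFun y := ⟨(y.1, ⟨y.2, by have := y.2.isLt; omega⟩), by have := y.2.isLt; simp only; omega⟩
  left_inv x := by rcases x with ⟨⟨a, b⟩, h⟩; rfl
  right_inv y := by rcases y with ⟨a, ⟨b, hb⟩⟩; rfl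

/-- `|Δₙ| = n(n+1)/2` ("There are `n(n+1)/2` triples"). [cite: CohnUmans2003, Theorem 6, proof] -/
theorem two_mul_card (n : ℕ) : 2 * Fintype.card (TriPt n) = n * (n + 1) := by
  rw [Fintype.card_congr (equivSigma n), Fintype.card_sigma]
  simp only [Fintype.card_fin]
  rw [Fin.sum_univ_eq_sum_range (fun i => n - i) n]
  have h := Finset.sum_range_reflect (fun i => i + 1) n
  -- ∑ (n - 1 - j + 1) = ∑ (j + 1)
  have h' : ∑ j ∈ range n, (n - j) = ∑ j ∈ range n, (j + 1) := by
    rw [← h]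
    apply Finset.sum_congr rfl
    intro j hj
    rw [Finset.mem_range] at hj
    omega
  rw [h', Finset.sum_add_distrib, Finset.sum_const, Finset.card_range, smul_eq_mul, mul_one]
  have := Finset.sum_range_id_mul_two n
  rcases Nat.eq_zero_or_pos n with rfl | hn
  · simp
  · have : (∑ i ∈ range n, i) * 2 + 2 * n = n * (n - 1) + 2 * n := by rw [this]
    have e : n * (n - 1) + 2 * n = n * (n + 1) := by
      obtain ⟨m, rfl⟩ := Nat.exists_eq_succ_of_ne_zero hn.ne'
      simp; ring
    omega

/-- `|Δₙ| = n(n+1)/2` ("There are `n(n+1)/2` triples"). [cite: CohnUmans2003, Theorem 6, proof] -/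
theorem card_eq (n : ℕ) : Fintype.card (TriPt n) = n * (n + 1) / 2 := by
  have := two_mul_card n
  omega

end TriPt

/-- The counting step (as in `StrongUSPFamilies.cksu_bit_witness`, for an arbitrary coordinate function `f`):
if for two permutations `σ, τ` every set bit of `f (σ x)` is a set bit of `f (τ x)`, for every `x`, then
`f ∘ σ = f ∘ τ` — the bit-filters `{x : bit i of f(σx)}` and `{x : bit i of f(τx)}` are equinumerous with
`{x : bit i of f x}`, so containment is equality.  This is the step behind "`π₁π₂⁻¹ ∈ H₁`" in the printed proofs
of CKSU Lemma 17 / Proposition 18. [cite: CohnKleinbergSzegedyUmans2005, Lemma 17 and Proposition 18 (§3.4), proof] -/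
theorem comp_eq_of_testBit_imp {α : Type*} [Fintype α] [DecidableEq α] (f : α → ℕ) (σ τ : Perm α)
    (h : ∀ x i, (f (σ x)).testBit i = true → (f (τ x)).testBit i = true) (x : α) : f (σ x) = f (τ x) := by
  classical
  have hcard : ∀ (ρ : Perm α) (i : ℕ),
      (univ.filter fun x => (f (ρ x)).testBit i = true).card = (univ.filter fun x => (f x).testBit i = true).card := by
    intro ρ i
    have hmap : (univ.filter fun x => (f (ρ x)).testBit i = true).map ρ.toEmbedding =
        univ.filter fun x => (f x).testBit i = true := by
      ext y
      simp only [Finset.mem_map, Finset.mem_filter, Finset.mem_univ, true_and, Equiv.toEmbedding_apply]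
      constructor
      · rintro ⟨x, hx, rfl⟩; exact hx
      · intro hy; exact ⟨ρ.symm y, by simpa using hy, by simp⟩
    rw [← hmap, Finset.card_map]
  have hsets : ∀ i : ℕ,
      (univ.filter fun x => (f (σ x)).testBit i = true) = univ.filter fun x => (f (τ x)).testBit i = true := by
    intro i
    apply Finset.eq_of_subset_of_card_le
    · intro x hx
      simp only [Finset.mem_filter, Finset.mem_univ, true_and] at hx ⊢
      exact h x i hx
    · rw [hcard σ i, hcard τ i]
  apply Nat.eq_of_testBit_eq
  intro i
  have hi := congrArg (fun s : Finset α => x ∈ s) (hsets i)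
  simp only [Finset.mem_filter, Finset.mem_univ, true_and, eq_iff_iff] at hi
  rcases Bool.eq_false_or_eq_true ((f (σ x)).testBit i) with h1 | h1 <;>
    rcases Bool.eq_false_or_eq_true ((f (τ x)).testBit i) with h2 | h2 <;> simp_all

/-- **The CKSU Prop. 18 rows** on `Δₙ`, `n = 2^k`, width `3k = (k + k) + k`: block 1 (symbols `1,2`, coded
`0,1`) carries the bits of `a`, block 2 (symbols `2,3`, coded `1,2`) the bits of `b`, block 3 (symbols `1,3`,
coded `0,2`) the bits of `c` — "the `a`-th pattern in the first `k` coordinates, the `b`-th in the second `k`,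
and the `c`-th in the third". [cite: CohnKleinbergSzegedyUmans2005, Proposition 18 (§3.4), proof] -/
def cksuTriangleRow (k : ℕ) (x : TriPt (2 ^ k)) (j : Fin (k + k + k)) : Fin 3 :=
  match finSumFinEquiv.symm j with
  | Sum.inl j' =>
    (match finSumFinEquiv.symm j' with
      | Sum.inl i => if (x.a).testBit i then 0 else 1
      | Sum.inr i => if (x.b).testBit i then 1 else 2)
  | Sum.inr i => if (x.c).testBit i then 0 else 2

/-- Block-1 entries. [folklore] -/
private theorem cksuTriangleRow_b1 {k : ℕ} (x : TriPt (2 ^ k)) (i : Fin k) :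
    cksuTriangleRow k x (finSumFinEquiv (Sum.inl (finSumFinEquiv (Sum.inl i)))) =
      if (x.a).testBit i then 0 else 1 := by
  unfold cksuTriangleRow; rw [Equiv.symm_apply_apply]; dsimp only; rw [Equiv.symm_apply_apply]

/-- Block-2 entries. [folklore] -/
private theorem cksuTriangleRow_b2 {k : ℕ} (x : TriPt (2 ^ k)) (i : Fin k) :
    cksuTriangleRow k x (finSumFinEquiv (Sum.inl (finSumFinEquiv (Sum.inr i)))) =
      if (x.b).testBit i then 1 else 2 := by
  unfold cksuTriangleRow; rw [Equiv.symm_apply_apply]; dsimp only; rw [Equiv.symm_apply_apply]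

/-- Block-3 entries. [folklore] -/
private theorem cksuTriangleRow_b3 {k : ℕ} (x : TriPt (2 ^ k)) (i : Fin k) :
    cksuTriangleRow k x (finSumFinEquiv (Sum.inr i)) = if (x.c).testBit i then 0 else 2 := by
  unfold cksuTriangleRow; rw [Equiv.symm_apply_apply]

/-- Bits at positions `≥ k` of the three coordinates vanish (all are `< 2^k`). [folklore] -/
private theorem testBit_coord_ge {k : ℕ} (x : TriPt (2 ^ k)) {i : ℕ} (hi : k ≤ i) :
    (x.a).testBit i = false ∧ (x.b).testBit i = false ∧ (x.c).testBit i = false := by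
  have hab := x.ab_lt
  have hk : 2 ^ k ≤ 2 ^ i := Nat.pow_le_pow_right (by norm_num) hi
  refine ⟨Nat.testBit_lt_two_pow ?_, Nat.testBit_lt_two_pow ?_, Nat.testBit_lt_two_pow ?_⟩
  · omega
  · omega
  · unfold TriPt.c; omega

/-- **CKSU Proposition 18, the strong-USP property of the triangle rows** (abstract form, permutations of `Δₙ`):
for all `σ₁, σ₂, σ₃ ∈ Sym(Δ_{2^k})`, either `σ₁ = σ₂ = σ₃` or some row `x` and column `j` have exactly two of
`(σ₁x)_j = 1`, `(σ₂x)_j = 2`, `(σ₃x)_j = 3`.  Proof: otherwise block 1 forces `a ∘ σ₁ = a ∘ σ₂`, block 2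
`b ∘ σ₂ = b ∘ σ₃`, block 3 `c ∘ σ₁ = c ∘ σ₃` (`comp_eq_of_testBit_imp`), so `h₁ = σ₁σ₂⁻¹`, `h₂ = σ₂σ₃⁻¹`,
`h₃ = σ₃σ₁⁻¹` fix the first/second/third coordinates with `h₁h₂h₃ = 1`, and the Cohn–Umans triangle theorem
gives `σ₁ = σ₂ = σ₃`. [cite: CohnKleinbergSzegedyUmans2005, Proposition 18 (§3.4, p. 7), proof via Lemma 17]
[cite: CohnUmans2003, Theorem 6] -/
theorem cksuTriangle_strong (k : ℕ) (σ₁ σ₂ σ₃ : Perm (TriPt (2 ^ k))) :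
    (σ₁ = σ₂ ∧ σ₂ = σ₃) ∨ ∃ x : TriPt (2 ^ k), ∃ j : Fin (k + k + k),
      USPExactlyTwo (cksuTriangleRow k (σ₁ x) j) (cksuTriangleRow k (σ₂ x) j) (cksuTriangleRow k (σ₃ x) j) := by
  classical
  by_cases hall : ∃ x : TriPt (2 ^ k), ∃ j : Fin (k + k + k),
      USPExactlyTwo (cksuTriangleRow k (σ₁ x) j) (cksuTriangleRow k (σ₂ x) j) (cksuTriangleRow k (σ₃ x) j)
  · exact Or.inr hall
  left
  push Not at hall
  -- block 1: a ∘ σ₁ = a ∘ σ₂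
  have hA : ∀ x, (σ₁ x).a = (σ₂ x).a := by
    refine comp_eq_of_testBit_imp (fun x : TriPt (2 ^ k) => x.a) σ₁ σ₂ ?_
    intro x i h1
    by_cases hi : i < k
    · have hx := hall x (finSumFinEquiv (Sum.inl (finSumFinEquiv (Sum.inl ⟨i, hi⟩))))
      rw [cksuTriangleRow_b1, cksuTriangleRow_b1, cksuTriangleRow_b1] at hx
      rw [h1] at hx
      by_contra h2
      simp only [Bool.not_eq_true] at h2
      rw [h2] at hx
      apply hx
      unfold USPExactlyTwo
      left
      refine ⟨by simp, by simp, ?_⟩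
      cases ((σ₃ x).a).testBit i <;> decide
    · push Not at hi
      rw [(testBit_coord_ge (σ₁ x) hi).1] at h1
      exact absurd h1 (by decide)
  -- block 2: b ∘ σ₂ = b ∘ σ₃
  have hB : ∀ x, (σ₂ x).b = (σ₃ x).b := by
    refine comp_eq_of_testBit_imp (fun x : TriPt (2 ^ k) => x.b) σ₂ σ₃ ?_
    intro x i h2
    by_cases hi : i < k
    · have hx := hall x (finSumFinEquiv (Sum.inl (finSumFinEquiv (Sum.inr ⟨i, hi⟩))))
      rw [cksuTriangleRow_b2, cksuTriangleRow_b2, cksuTriangleRow_b2] at hx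
      rw [h2] at hx
      by_contra h3
      simp only [Bool.not_eq_true] at h3
      rw [h3] at hx
      apply hx
      unfold USPExactlyTwo
      right; right
      refine ⟨?_, by simp, by simp⟩
      cases ((σ₁ x).b).testBit i <;> decide
    · push Not at hi
      rw [(testBit_coord_ge (σ₂ x) hi).2.1] at h2
      exact absurd h2 (by decide)
  -- block 3: c ∘ σ₁ = c ∘ σ₃
  have hC : ∀ x, (σ₁ x).c = (σ₃ x).c := by
    refine comp_eq_of_testBit_imp (fun x : TriPt (2 ^ k) => x.c) σ₁ σ₃ ?_
    intro x i h1
    by_cases hi : i < k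
    · have hx := hall x (finSumFinEquiv (Sum.inr ⟨i, hi⟩))
      rw [cksuTriangleRow_b3, cksuTriangleRow_b3, cksuTriangleRow_b3] at hx
      rw [h1] at hx
      by_contra h3
      simp only [Bool.not_eq_true] at h3
      rw [h3] at hx
      apply hx
      unfold USPExactlyTwo
      right; left
      refine ⟨by simp, ?_, by simp⟩
      cases ((σ₂ x).c).testBit i <;> decide
    · push Not at hi
      rw [(testBit_coord_ge (σ₁ x) hi).2.2] at h1
      exact absurd h1 (by decide)
  -- the three quotients fix a, b, c respectively and multiply to 1
  have key := TriPt.triangle_tpp (σ₁ * σ₂⁻¹) (σ₂ * σ₃⁻¹) (σ₃ * σ₁⁻¹)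
    (fun y => by simpa using hA (σ₂⁻¹ y))
    (fun y => by simpa using hB (σ₃⁻¹ y))
    (fun y => by simpa using (hC (σ₁⁻¹ y)).symm)
    (fun y => by simp)
  obtain ⟨k1, k2, -⟩ := key
  rw [mul_inv_eq_one] at k1 k2
  exact ⟨k1, k2⟩

/-- **The CKSU Prop. 18 strong USP as a `Fin`-indexed puzzle** (rows of `Δ_{2^k}` enumerated by
`Fintype.equivFin`; `|Δ_{2^k}| = 2^{k−1}(2^k+1)` by `TriPt.card_eq`).
[cite: CohnKleinbergSzegedyUmans2005, Proposition 18 (§3.4, p. 7)] -/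
noncomputable def cksuTriangleUSP (k : ℕ) :
    Fin (Fintype.card (TriPt (2 ^ k))) → Fin (k + k + k) → Fin 3 :=
  fun u j => cksuTriangleRow k ((Fintype.equivFin (TriPt (2 ^ k))).symm u) j

/-- **Cohn–Kleinberg–Szegedy–Umans 2005, Proposition 3.8 / 18**: the triangle puzzle is a strong USP (transport
of `cksuTriangle_strong` along `Fintype.equivFin`). [cite: CohnKleinbergSzegedyUmans2005, Proposition 18 (§3.4, p. 7)] -/
theorem isStrongUSP_cksuTriangleUSP (k : ℕ) : IsStrongUSP (cksuTriangleUSP k) := by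
  classical
  intro π₁ π₂ π₃
  set e := (Fintype.equivFin (TriPt (2 ^ k))).symm with he
  -- conjugate the permutations to permutations of the triangle
  let σ : Perm (Fin (Fintype.card (TriPt (2 ^ k)))) → Perm (TriPt (2 ^ k)) :=
    fun π => e.symm.trans (π.trans e)
  have hσ : ∀ π x, σ π x = e (π (e.symm x)) := fun π x => rfl
  rcases cksuTriangle_strong k (σ π₁) (σ π₂) (σ π₃) with ⟨h12, h23⟩ | ⟨x, j, hx⟩
  · left
    have back : ∀ π π' : Perm (Fin (Fintype.card (TriPt (2 ^ k)))), σ π = σ π' → π = π' := by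
      intro π π' h
      ext u : 1
      have := congrArg (fun ρ : Perm (TriPt (2 ^ k)) => e.symm (ρ (e u))) h
      simpa [hσ] using this
    exact ⟨back _ _ h12, back _ _ h23⟩
  · right
    refine ⟨e.symm x, j, ?_⟩
    simpa [cksuTriangleUSP, hσ, he] using hx

/-- **Cohn–Kleinberg–Szegedy–Umans 2005, Proposition 3.8 / 18, AS PRINTED**: "For each `k ≥ 1`, there exists a
strong USP of size `2^{k−1}(2^k+1)` and width `3k`" (here for every `k`; at `k = 0` the size is `1`).
[cite: CohnKleinbergSzegedyUmans2005, Proposition 18 (§3.4, p. 7)] -/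
theorem CohnKleinbergSzegedyUmans2005_prop18 (k : ℕ) :
    ∃ row : Fin (2 ^ k * (2 ^ k + 1) / 2) → Fin (3 * k) → Fin 3, IsStrongUSP row := by
  have hcard : Fintype.card (TriPt (2 ^ k)) = 2 ^ k * (2 ^ k + 1) / 2 := TriPt.card_eq (2 ^ k)
  have h3 : 3 * k = k + k + k := by ring
  rw [← hcard, h3]
  exact ⟨cksuTriangleUSP k, isStrongUSP_cksuTriangleUSP k⟩

section Capacity

/-! ### "It follows that the strong USP capacity is at least `2^{2/3}`" (CKSU 2005, Prop. 18, second sentence)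

CKSU define the strong USP capacity as "the largest constant `C` such that there exist strong USPs of size
`(C − o(1))^k` and width `k` for infinitely many values of `k`".  The printed consequence of Proposition 18 in that
language: for every `C < 2^{2/3}` there are strong USPs of width `k` and size `≥ C^k` for arbitrarily large `k`
(namely the triangle puzzles: width `3k'`, size `2^{k'−1}(2^{k'}+1) ≥ 4^{k'}/2`). -/

/-- **CKSU 2005, Proposition 18, second sentence: "the strong USP capacity is at least `2^{2/3}`"** — for every
`0 ≤ C < 2^{2/3}` and every `K` there is a strong USP of some width `k ≥ K` with at least `C^k` rows.
[cite: CohnKleinbergSzegedyUmans2005, Proposition 18 (§3.4, p. 7)] -/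
theorem exists_isStrongUSP_card_ge_pow (C : ℝ) (hC0 : 0 ≤ C) (hC : C < (2 : ℝ) ^ (2 / 3 : ℝ)) (K : ℕ) :
    ∃ k ≥ K, ∃ s : ℕ, ∃ row : Fin s → Fin k → Fin 3, IsStrongUSP row ∧ C ^ k ≤ (s : ℝ) := by
  -- C³ < 4
  have hC3 : C ^ 3 < 4 := by
    have h4 : ((2 : ℝ) ^ (2 / 3 : ℝ)) ^ 3 = 4 := by
      rw [← Real.rpow_mul_natCast (by norm_num)]; norm_num
    rw [← h4]
    exact pow_lt_pow_left₀ hC hC0 (by norm_num)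
  have hC3nn : 0 ≤ C ^ 3 := pow_nonneg hC0 3
  -- choose k' ≥ K with 2 · (C³)^{k'} ≤ 4^{k'}
  obtain ⟨k', hk'K, hk'⟩ : ∃ k' : ℕ, K ≤ k' ∧ 2 * (C ^ 3) ^ k' ≤ (4 : ℝ) ^ k' := by
    rcases eq_or_lt_of_le hC3nn with h0 | hpos
    · refine ⟨K + 1, by omega, ?_⟩
      rw [← h0, zero_pow (by omega), mul_zero]; positivity
    · have hq : 1 < 4 / C ^ 3 := by rw [lt_div_iff₀ hpos]; linarith
      obtain ⟨n, hn⟩ := pow_unbounded_of_one_lt (2 : ℝ) hq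
      refine ⟨max n K, le_max_right _ _, ?_⟩
      have hmono : (4 / C ^ 3) ^ n ≤ (4 / C ^ 3) ^ max n K := pow_le_pow_right₀ hq.le (le_max_left _ _)
      have h2 : 2 ≤ (4 / C ^ 3) ^ max n K := le_trans hn.le hmono
      rw [div_pow, le_div_iff₀ (pow_pos hpos _)] at h2
      linarith
  -- the triangle puzzle of width 3k'
  refine ⟨k' + k' + k', by omega, Fintype.card (TriPt (2 ^ k')), cksuTriangleUSP k',
    isStrongUSP_cksuTriangleUSP k', ?_⟩
  have h2s : 2 * Fintype.card (TriPt (2 ^ k')) = 2 ^ k' * (2 ^ k' + 1) := TriPt.two_mul_card (2 ^ k')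
  have hs : (4 : ℝ) ^ k' ≤ 2 * (Fintype.card (TriPt (2 ^ k')) : ℝ) := by
    have hnat : 4 ^ k' ≤ 2 * Fintype.card (TriPt (2 ^ k')) := by
      rw [h2s, show (4 : ℕ) = 2 * 2 by rfl, mul_pow]
      exact Nat.mul_le_mul_left _ (Nat.le_succ _)
    exact_mod_cast hnat
  have e : C ^ (k' + k' + k') = (C ^ 3) ^ k' := by rw [← pow_mul]; congr 1; ring
  rw [e]
  linarith

end Capacity

end Literature.Computability.AlgebraicComplexity
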